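import Summits.NavierStokesRegularity.NavierStokesRegularity.Theses.AdiabaticEddy
import Summits.NavierStokesRegularity.NavierStokesRegularity.Theorems.AdiabaticEddyClayUniquenessCore

/-!
# Route AdiabaticEddy — `ClayUniqueness` (item stmt-NavierStokesRegularity-0153, `X5b`)

Closing file: the route decl `AdiabaticEddy.ClayUniqueness` (shared verbatim with `Blowup.BlowupClayUniqueness`
and the `ClayUniqueness` of 15 further negative-side routes) is, by `Iff.rfl`, the raw theorem
`Summit.NavierStokesRegularity.NavierStokesRegularity.Theorems.blowup_clay_uniqueness`
(`AdiabaticEddyClayUniquenessCore.lean`: Tao 2013 Cor. 11.4 = in-tree discharge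
`tao_unconditional_uniqueness_velocity_holds`, glued on closed sub-slabs `[0, t]`, `t < T`).
-/

-- the summit-side namespace `Summit.NavierStokesRegularity.NavierStokesRegularity.…` repeats a component by design (D-0017)
set_option linter.dupNamespace false

namespace Summit.NavierStokesRegularity.NavierStokesRegularity.Theorems

/-- **Settles stmt-NavierStokesRegularity-0153** (`X5b`, support of route AdiabaticEddy and 16 other
negative-side routes): a Fefferman class-(A) solution from a rapidly decaying datum agrees on `[0, T)` with
the classical Leray–Hopf solution from the same datum.  The route decl unfolds to
`blowup_clay_uniqueness` (Tao 2013, Cor. 11.4, via `tao_unconditional_uniqueness_velocity_holds`).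
[cite: Tao2011, Cor. 11.4 (arXiv:1108.1165 Cor. 71, p. 36)] -/
theorem adiabaticEddy_clayUniqueness_proof :
    Summit.NavierStokesRegularity.NavierStokesRegularity.Theses.AdiabaticEddy.ClayUniqueness := by
  unfold Summit.NavierStokesRegularity.NavierStokesRegularity.Theses.AdiabaticEddy.ClayUniqueness
  exact blowup_clay_uniqueness

end Summit.NavierStokesRegularity.NavierStokesRegularity.Theorems
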